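import Summits.MatrixMultiplication.MatrixMultiplication.Theorems.SaturationLadderPerfectPacking
import Literature.Computability.AlgebraicComplexity.SchoenhageExampleProofs
import HarnessLib

/-!
# Route `SaturationLadder`, census kernel I-g37a/I-g38a: the EXACT THIN POINTS of Schönhage's pairs

decomp-mm census instrument `decomp-mm-census-1`, gen 38 (offer I-g37a of COSTUME-CENSUS v37, taken up by
lens 1 (NODE g49: «census I-g37a welcome») and by the critic (l.2488: «the two offers I would take first»)).
Def-free, sorry-free, THESES-FREE support module beneath the deciding crux `SubexpSaturation`
(stmt-MatrixMultiplication-25909) of `route-MatrixMultiplication-SaturationLadder`; cut of record UNCHANGED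
(`closes (h₁ : SubexpSaturation) (h₂ : SubexpToPoly) (h₃ : PolyToFinite) (h₄ : TailDescentTwo) (h₅ : SquareFromTwo)`).

Kernel K48-P (`SaturationLadderPerfectPacking`) reads an OUTPUT-PERFECT border-rank certificate
`R̲(⊕ᵢ⟨aᵢ,bᵢ,cᵢ⟩) ≤ ∑ᵢ aᵢcᵢ` as the exact thin tight point `ω_K(1, B/A, C/A) = 1 + C/A`,
`(A,B,C) = ∑ᵢ aᵢcᵢ (log aᵢ, log bᵢ, log cᵢ)`, and instantiated it once, on `E₃ = ⟨1,4,1⟩ ⊕ ⟨3,1,3⟩`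
(`plateau_schoenhageE3`: `ω_K(1, log 4/(9 log 3), 1) = 2`).  The Literature holds Schönhage's whole family
as a PROVED border-rank identity (BCS (15.12), `algBorderRank_schoenhageExample`:
`R̲(⟨e,1,l⟩ ⊕ ⟨1,(e−1)(l−1),1⟩) = el + 1`, `e, l ≥ 2`, every field) — output-perfect, since the two blocks have
`el + 1` output entries.  Here the two are composed, by name, for the whole family:

* §1 `thinTight_schoenhagePair`, **`thinPoint_schoenhagePair`**: for `e, l ≥ 2` and every field `K`,
  `ω_K(1, log((e−1)(l−1))/(e·l·log e), log l/log e) = 1 + log l/log e` — an exact RECTANGULAR thin tight point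
  (`A = el·log e`, `B = log((e−1)(l−1))`, `C = el·log l`; lower bound `1 + r ≤ ω(1,t,r)` from the Literature's
  information bound `add_le_omegaRect₁₃`).
* §2 instances by name: `thinPoint_schoenhage_two_five` — the family's THINNEST member `(e,l) = (2,5)`:
  `ω_K(1, 1/5, log 5/log 2) = 1 + log 5/log 2` (`t = log 4/(10 log 2) = 1/5`, the family's `sup` of `t`, census
  v37 row I147; heavy third side `r = log₂5`); `plateau_schoenhageSquare` — the diagonal `e = l = n ≥ 2`:
  `ω_K(1, log((n−1)²)/(n²·log n), 1) = 2`, a PLATEAU for every `n` (`n = 3` is literally `plateau_schoenhageE3`;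
  `n = 4`: `plateau_schoenhageSquare_four`, `ω_K(1, log 9/(16 log 4), 1) = 2`).

What it is for.  Lens 1's SUFF leaf `subexpSaturation_of_perfectPackings` needs output-perfect packings with
`t ↑ 1`; this file makes the census statement «every perfect packing the tree can name has t ≤ 1/5» a
by-name fact about points of `ω_K` (ILLUSTRATION grade: none of these points is new in print, all lie below
Coppersmith's `α = 0.17227…` in the `t`-coordinate except the five heavy-`r` members `(2,4..8)` recorded in
census v37, and none bears on `h₁`).  The isolated-anchor REALIZATIONS of the same pairs (the input of the
squaring towers) are lens 2's kernel XXXV-C `FarEdgeDescentSchonhagePairBase` (gen 55), not used here.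

References: Schönhage 1981, §5; Bürgisser–Clausen–Shokrollahi 1997, (15.12) and Thm. (15.51);
Coppersmith 1982; Huang–Pan 1998, (2.8).
Tags: `SubexpSaturation` (h₁) NEC · WEAKER · ATTACKED (unchanged) · rows ILLUSTRATION.  No defs.
[cite: Schonhage1981, §5] [cite: BurgisserClausenShokrollahi1997, (15.12)]
[cite: Coppersmith1982, Theorem (BCS 1997 Thm. (15.51))] [cite: HuangPan1998, §2 eq. (2.8) (p. 262)]
-/

set_option linter.dupNamespace false

noncomputable section

open scoped BigOperators

namespace Summit.MatrixMultiplication.MatrixMultiplication.Theorems.SaturationLadderSchoenhagePairPoints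

open Literature.Computability.AlgebraicComplexity
open Summit.MatrixMultiplication.MatrixMultiplication.Theorems.SaturationLadderPerfectPacking

variable {K : Type} [Field K]

/-! ## §1 The exact thin point of the pair `⟨e,1,l⟩ ⊕ ⟨1,(e−1)(l−1),1⟩` -/

/-- **Thin tight point of a Schönhage pair (upper half)**: for `e, l ≥ 2` and every field,
`ω_K(1, log((e−1)(l−1))/(el·log e), log l/log e) ≤ 1 + log l/log e` — K48-P's `thinTight_of_perfectBorderRank` on
the OUTPUT-PERFECT certificate `R̲(⟨e,1,l⟩ ⊕ ⟨1,(e−1)(l−1),1⟩) = el + 1` (BCS (15.12), proved in the Literature).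
[cite: BurgisserClausenShokrollahi1997, (15.12)] [cite: Coppersmith1982, Theorem (BCS 1997 Thm. (15.51))] -/
theorem thinTight_schoenhagePair {e l : ℕ} (he : 2 ≤ e) (hl : 2 ≤ l) :
    omegaRect K 1 (Real.log (((e - 1) * (l - 1) : ℕ) : ℝ) / ((e : ℝ) * l * Real.log e))
        (Real.log l / Real.log e) ≤ 1 + Real.log l / Real.log e := by
  have he1 : (1 : ℝ) < e := by exact_mod_cast he
  have hl1 : (1 : ℝ) < l := by exact_mod_cast hl
  have hloge : 0 < Real.log e := Real.log_pos he1
  have hel : (0 : ℝ) < (e : ℝ) * l := by positivity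
  have he' : 1 ≤ e := by omega
  have hl' : 1 ≤ l := by omega
  have hq : 1 ≤ (e - 1) * (l - 1) := Nat.mul_pos (by omega) (by omega)
  have hpos : ∀ i : Fin 2, 1 ≤ (![e, 1] : Fin 2 → ℕ) i ∧ 1 ≤ (![1, (e - 1) * (l - 1)] : Fin 2 → ℕ) i ∧
      1 ≤ (![l, 1] : Fin 2 → ℕ) i := by
    intro i
    fin_cases i <;> simp [he', hl', hq]
  have hr : algBorderRank (matMulDirectSum K ![e, 1] ![1, (e - 1) * (l - 1)] ![l, 1]) ≤
      ∑ i, (![e, 1] : Fin 2 → ℕ) i * (![l, 1] : Fin 2 → ℕ) i := by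
    rw [algBorderRank_schoenhageExample K he hl, Fin.sum_univ_two]
    simp
  have hA : 0 < ∑ i : Fin 2, ((![e, 1] : Fin 2 → ℕ) i : ℝ) * ((![l, 1] : Fin 2 → ℕ) i) *
      Real.log ((![e, 1] : Fin 2 → ℕ) i) := by
    rw [Fin.sum_univ_two]
    simp only [Matrix.cons_val_zero, Matrix.cons_val_one, Nat.cast_one, Real.log_one, mul_zero, add_zero]
    positivity
  have h := thinTight_of_perfectBorderRank (K := K) hpos (by norm_num) hr hA
  simp only [Fin.sum_univ_two, Matrix.cons_val_zero, Matrix.cons_val_one, Nat.cast_one, Real.log_one,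
    mul_zero, add_zero, zero_add, one_mul, mul_one] at h
  have hC : (e : ℝ) * l * Real.log l / ((e : ℝ) * l * Real.log e) = Real.log l / Real.log e := by
    rw [mul_div_mul_left _ _ hel.ne']
  rw [hC] at h
  exact h

/-- **THE EXACT THIN POINT OF A SCHÖNHAGE PAIR**: for `e, l ≥ 2` and every field `K`,
`ω_K(1, log((e−1)(l−1))/(el·log e), log l/log e) = 1 + log l/log e` (upper half: the output-perfect certificate
BCS (15.12) read by K48-P; lower half: the information bound `1 + r ≤ ω(1,t,r)`).
[cite: Schonhage1981, §5] [cite: BurgisserClausenShokrollahi1997, (15.12)]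
[cite: Coppersmith1982, Theorem (BCS 1997 Thm. (15.51))] [cite: HuangPan1998, §2 eq. (2.8) (p. 262)] -/
theorem thinPoint_schoenhagePair {e l : ℕ} (he : 2 ≤ e) (hl : 2 ≤ l) :
    omegaRect K 1 (Real.log (((e - 1) * (l - 1) : ℕ) : ℝ) / ((e : ℝ) * l * Real.log e))
        (Real.log l / Real.log e) = 1 + Real.log l / Real.log e :=
  le_antisymm (thinTight_schoenhagePair he hl) (add_le_omegaRect₁₃ K 1 _ _)

/-! ## §2 Instances by name: the thinnest member `(2,5)` and the diagonal plateaux -/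

/-- **The thinnest Schönhage pair `(e,l) = (2,5)`**: `ω_K(1, 1/5, log 5/log 2) = 1 + log 5/log 2` over every field
(`⟨2,1,5⟩ ⊕ ⟨1,4,1⟩`, `R̲ = 11`; `t = log 4/(10·log 2) = 1/5` is the `sup` of the family's thin weight, `r = log₂ 5`).
[cite: Schonhage1981, §5] [cite: BurgisserClausenShokrollahi1997, (15.12)] -/
theorem thinPoint_schoenhage_two_five :
    omegaRect K 1 (1 / 5) (Real.log 5 / Real.log 2) = 1 + Real.log 5 / Real.log 2 := by
  have h := thinPoint_schoenhagePair (K := K) (e := 2) (l := 5) (by norm_num) (by norm_num)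
  have h4 : Real.log (((2 - 1) * (5 - 1) : ℕ) : ℝ) = 2 * Real.log 2 := by
    rw [show (((2 - 1) * (5 - 1) : ℕ) : ℝ) = 2 ^ 2 by norm_num, Real.log_pow]
    norm_num
  have hlog2 : Real.log 2 ≠ 0 := (Real.log_pos (by norm_num)).ne'
  have ht : Real.log (((2 - 1) * (5 - 1) : ℕ) : ℝ) / ((2 : ℕ) * ((5 : ℕ) : ℝ) * Real.log (2 : ℕ)) = 1 / 5 := by
    rw [h4]
    push_cast
    field_simp
  rw [ht] at h
  exact_mod_cast h

/-- **THE DIAGONAL PLATEAUX**: for every `n ≥ 2` and every field, `ω_K(1, log((n−1)²)/(n²·log n), 1) = 2`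
(`⟨n,1,n⟩ ⊕ ⟨1,(n−1)²,1⟩`, `R̲ = n² + 1`; `r = log n/log n = 1`).  At `n = 3` this is LITERALLY K48-P's
`plateau_schoenhageE3` (`log 4/(9 log 3)`; not restated here — the gate's dedup check confirms the identity).
[cite: Schonhage1981, §5] [cite: BurgisserClausenShokrollahi1997, (15.12)] -/
theorem plateau_schoenhageSquare {n : ℕ} (hn : 2 ≤ n) :
    omegaRect K 1 (Real.log (((n - 1) * (n - 1) : ℕ) : ℝ) / ((n : ℝ) * n * Real.log n)) 1 = 2 := by
  have h := thinPoint_schoenhagePair (K := K) hn hn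
  have hlog : Real.log n ≠ 0 := (Real.log_pos (by exact_mod_cast hn : (1 : ℝ) < n)).ne'
  rw [div_self hlog] at h
  rw [h]
  norm_num

/-- `n = 4`: `ω_K(1, log 9/(16 log 4), 1) = 2` (`⟨4,1,4⟩ ⊕ ⟨1,9,1⟩` by `17`, Schönhage's `ω < 2.548` base;
`t = 0.0990…`). [cite: Schonhage1981, §5] [cite: BurgisserClausenShokrollahi1997, (15.12)] -/
theorem plateau_schoenhageSquare_four : omegaRect K 1 (Real.log 9 / (16 * Real.log 4)) 1 = 2 := by
  have h := plateau_schoenhageSquare (K := K) (n := 4) (by norm_num)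
  have h' : Real.log ((((4 - 1) * (4 - 1) : ℕ)) : ℝ) / (((4 : ℕ) : ℝ) * (4 : ℕ) * Real.log (4 : ℕ)) =
      Real.log 9 / (16 * Real.log 4) := by
    norm_num
  rw [h'] at h
  exact h

end Summit.MatrixMultiplication.MatrixMultiplication.Theorems.SaturationLadderSchoenhagePairPoints

end
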